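import Mathlib
import Summits.ValiantsHypothesis.ValiantsHypothesis.Theorems.LacunarySymmetroidMatrixDescartesCensusRealExponentsFamilyTransfer
import Summits.ValiantsHypothesis.ValiantsHypothesis.Theorems.LacunarySymmetroidMatrixDescartesCensusRealExponentsThreeByThree
import Summits.ValiantsHypothesis.ValiantsHypothesis.Theorems.LacunarySymmetroidMatrixDescartesCensusRealExponentsAllSizesKit

/-!
# `MatrixDescartes` census — symmetric pencils of EVERY size: the real-exponent transfer for every bound

HONEST FRAMING.  Object-search cell `pub-symmetroid`, items `DoorA26 = PosRootLawAt 2 6 19`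
(stmt-ValiantsHypothesis-19979) / `DoorA34 = PosRootLawAt 3 4 18` (stmt-ValiantsHypothesis-19980),
OPEN, typed, never asserted; this file proves, for EVERY matrix size `m`, every `K` and every `B`,
that the integer row `PosRootLawAt m K B` is EQUIVALENT to its real-exponent form — the size-free
version of `posRootLawAt_two_iff_rpow` (…TwoByTwo) and `posRootLawAt_three_iff_rpow` (…ThreeByThree),
with no sharpness hypothesis.  Decides nothing; nothing here bears on `MatrixDescartes`
(stmt-ValiantsHypothesis-18050) or `VP ≠ VNP`.

* `exists_signVar_of_zeros_symm` — if `t ↦ det ∑_l e^{δ_l t} S_l` (`S_l` real symmetric `m × m`) has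
  `≥ N ≥ 1` zeros then, after ONE-letter perturbation `S₀ ↦ S₀ + εW` (`W` symmetric), the pencil has
  `≥ N` consecutive sign variations along a strictly increasing point sequence (same exponents);
* `posRootLawAt_iff_rpow_all (m K B)` — **`PosRootLawAt m K B ↔ ∀ δ : Fin K → ℝ, ∀ S symmetric,
  #{x > 0 : det ∑_l x^{δ_l} S_l = 0} ≤ B`**; `not_posRootLawAt_iff_all` — negation currency.

PROOF.  At a zero `z`, write `F(z) = U·diag(λ)·Uᵀ` (spectral theorem) with zero set `Z` of size
`d = corank`; for any letter `V` with non-singular kernel block `V_Z = (UᵀVU)_Z` the Schur factorisation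
(`det_diagonal_add_smul_eq`, …AllSizesKit) gives `det(F(z) + xV) = x^d · det V_Z · g(x)` with `g`
continuous, `g(0) = ∏_{λ_i ≠ 0} λ_i ≠ 0`, so the sign for small `x = ±εE` is `(±1)^d·sign det V_Z·sign g(0)`.
For the family `{±1, ±W}`, `W = 1 − κ·nnᵀ`: `det 1_Z = 1` and `det W_Z = 1 − κ·|proj_{ker F(z)} n|²`
(`det_one_sub_smul_vecMulVec'`), which is NEGATIVE once `n` is seen by the kernel of every zero (moment
curve `n = (t^j)_j` off a finite set: a kernel eigenvector's moment polynomial has finitely many roots)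
and `κ = 1 + Σ_z 1/q_z`.  The four signs are then `s, (−1)^d s, −s, −(−1)^d s`: exactly balanced, with
NO corank case split (`balance_of_opposite_pairs`); `exists_signVar_of_zeros_family` and
`card_signVar_le` finish as at sizes `2` and `3`.

[folklore] Spectral theorem + Schur complement; elementary perturbation bookkeeping.
-/

-- `Summit.ValiantsHypothesis.ValiantsHypothesis.…` repeats a component by the D-0017 layout
-- (single-conjunct summit), which the `dupNamespace` linter flags; the name is mandated.
set_option linter.dupNamespace false

namespace Summit.ValiantsHypothesis.ValiantsHypothesis.Theorems.LacunarySymmetroidMatrixDescartes.Census.RealExp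

open Finset Filter Topology Matrix
open scoped BigOperators Matrix
open Summit.ValiantsHypothesis.ValiantsHypothesis.Theorems.MatrixDescartes.Negative (PosRootLawAt)

section AllSizes

-- One long elementary proof (direction `n`, size `κ`, eventual signs at every zero); measured above
-- the default budget.
set_option maxHeartbeats 800000 in
open Classical in
/-- **Zeros become sign variations after a one-letter perturbation (every size, real exponents).**
If `t ↦ det ∑_l e^{δ_l t} S_l` (any number `k+1` of real symmetric `m × m` letters) has at least
`N ≥ 1` zeros, then for some symmetric `W` and some `ε` the pencil with `S₀` replaced by `S₀ + εW` has
at least `N` consecutive sign variations along some strictly increasing point sequence (module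
docstring). [folklore] -/
theorem exists_signVar_of_zeros_symm {m k N : ℕ} (δ : Fin (k + 1) → ℝ)
    (S : Fin (k + 1) → Matrix (Fin m) (Fin m) ℝ) (hS : ∀ l, (S l).IsSymm) (hN0 : 0 < N)
    (hN : N ≤ {t : ℝ | (∑ l, Real.exp (δ l * t) • S l).det = 0}.ncard) :
    ∃ (W : Matrix (Fin m) (Fin m) ℝ) (ε : ℝ), W.IsSymm ∧ ∃ (M : ℕ) (p : Fin (M + 1) → ℝ),
      StrictMono p ∧ N ≤ (univ.filter (fun i : Fin M =>
        (∑ l, Real.exp (δ l * p i.castSucc) • Function.update S 0 (S 0 + ε • W) l).det *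
        (∑ l, Real.exp (δ l * p i.succ) • Function.update S 0 (S 0 + ε • W) l).det < 0)).card := by
  classical
  -- the real-exponent pencil, its determinant and its (finite) zero set
  set F : ℝ → Matrix (Fin m) (Fin m) ℝ := fun t => ∑ l, Real.exp (δ l * t) • S l with hF
  set G : ℝ → ℝ := fun t => (F t).det with hG
  have hFsymm : ∀ t, (F t).IsSymm := fun t => isSymm_sum_smul _ S hS
  have hH : ∀ t, (F t).IsHermitian := fun t => isHermitian_iff_isSymm.mpr (hFsymm t)
  set Zt : Set ℝ := {t | G t = 0} with hZt
  change N ≤ Zt.ncard at hN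
  have hfin : Zt.Finite := Set.finite_of_ncard_ne_zero (by omega)
  obtain ⟨Zf, hZfmem⟩ : ∃ Zf : Finset ℝ, ∀ x, x ∈ Zf ↔ x ∈ Zt :=
    ⟨hfin.toFinset, fun x => hfin.mem_toFinset⟩
  have hZf : ∀ z, G z = 0 → z ∈ Zf := fun z hz => (hZfmem z).mpr hz
  -- eigen-data at every point (made opaque: only the equations `hUz`, `heig` are used)
  obtain ⟨U, hUz⟩ : ∃ U : ℝ → Matrix (Fin m) (Fin m) ℝ,
      ∀ z, U z = ((hH z).eigenvectorUnitary : Matrix (Fin m) (Fin m) ℝ) := ⟨_, fun z => rfl⟩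
  obtain ⟨eig, heig⟩ : ∃ eig : ℝ → Fin m → ℝ, ∀ z, (hH z).eigenvalues = eig z := ⟨_, fun z => rfl⟩
  -- STEP 1: a direction on the moment curve seen by the kernel of every zero
  set nv : ℝ → (Fin m → ℝ) := fun t j => t ^ (j : ℕ) with hnv
  set Bad : ℝ → Set ℝ := fun z => {t | ∀ i, eig z i = 0 → (fun a => U z a i) ⬝ᵥ nv t = 0} with hBad
  have hBadfin : ∀ z, G z = 0 → (Bad z).Finite := by
    intro z hz
    obtain ⟨i, hi⟩ := exists_eigenvalues_eq_zero (hH z) hz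
    rw [heig z] at hi
    have hcol := eigenvectorUnitary_col_ne_zero (hH z) i
    rw [← hUz z] at hcol
    exact (finite_setOf_dotProduct_pow_eq_zero hcol).subset fun t ht => ht i hi
  have hUnion : (⋃ z ∈ (↑Zf : Set ℝ), Bad z).Finite :=
    Set.Finite.biUnion Zf.finite_toSet fun z hz => hBadfin z ((hZfmem z).mp hz)
  obtain ⟨t, ht⟩ := hUnion.exists_notMem
  set n : Fin m → ℝ := nv t with hn
  have hn_good : ∀ z, G z = 0 → ∃ i, eig z i = 0 ∧ (fun a => U z a i) ⬝ᵥ n ≠ 0 := by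
    intro z hz
    by_contra hall
    push Not at hall
    apply ht
    rw [Set.mem_iUnion₂]
    exact ⟨z, hZf z hz, hall⟩
  -- the kernel weight of `n` at each point
  set w : ℝ → (Fin m → ℝ) := fun z => n ᵥ* U z with hw
  set q : ℝ → ℝ := fun z =>
    (fun i : {i // eig z i = 0} => w z i) ⬝ᵥ (fun i : {i // eig z i = 0} => w z i) with hq
  have hq_nonneg : ∀ z, 0 ≤ q z := fun z => by
    simp only [hq, dotProduct]
    exact Finset.sum_nonneg fun i _ => mul_self_nonneg _
  have hq_pos : ∀ z, G z = 0 → 0 < q z := by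
    intro z hz
    obtain ⟨i, hi, hne⟩ := hn_good z hz
    have hwi : w z i ≠ 0 := by
      have : w z i = (fun a => U z a i) ⬝ᵥ n := by
        simp only [hw, Matrix.vecMul, dotProduct]
        exact Finset.sum_congr rfl fun a _ => mul_comm _ _
      rw [this]; exact hne
    have hle : w z i * w z i ≤ q z := by
      simp only [hq, dotProduct]
      exact Finset.single_le_sum (f := fun i' : {i' // eig z i' = 0} => w z i' * w z i')
        (fun _ _ => mul_self_nonneg _) (Finset.mem_univ (⟨i, hi⟩ : {i' // eig z i' = 0}))
    have hpos : 0 < w z i * w z i := mul_self_pos.mpr hwi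
    linarith
  -- STEP 2: the size of the dent
  set κ : ℝ := 1 + ∑ z ∈ Zf, 1 / q z with hκ
  have hκq : ∀ z, G z = 0 → κ * q z > 1 := by
    intro z hz
    have hqz := hq_pos z hz
    have hsum : 1 / q z ≤ ∑ z' ∈ Zf, 1 / q z' :=
      Finset.single_le_sum (f := fun z' => 1 / q z') (fun z' _ => by
        have := hq_nonneg z'; positivity) (hZf z hz)
    have h1 : 1 / q z * q z = 1 := by field_simp
    nlinarith
  set W : Matrix (Fin m) (Fin m) ℝ := (1 : Matrix (Fin m) (Fin m) ℝ) - κ • vecMulVec n n with hW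
  have hWsymm : W.IsSymm :=
    Matrix.isSymm_one.sub ((Matrix.IsSymm.ext fun i j => by simp [vecMulVec_apply, mul_comm]).smul κ)
  -- STEP 3: the four-member family and the perturbed determinants
  set V : Bool → Matrix (Fin m) (Fin m) ℝ := fun b => if b then 1 else W with hV
  set sg : Bool → ℝ := fun b => if b then 1 else -1 with hsg
  have hsg_ne : ∀ b, sg b ≠ 0 := fun b => by cases b <;> simp [hsg]
  set Mw : Bool × Bool → Matrix (Fin m) (Fin m) ℝ := fun w' => sg w'.2 • V w'.1 with hMw
  have hVsymm : ∀ b, (V b).IsSymm := fun b => by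
    cases b
    · exact hWsymm
    · exact Matrix.isSymm_one
  have hMsymm : ∀ w', (Mw w').IsSymm := fun w' => (hVsymm w'.1).smul _
  set P : Bool × Bool → ℝ → ℝ → ℝ :=
    fun w' ε t => (F t + (ε * Real.exp (δ 0 * t)) • Mw w').det with hP
  have hP_det : ∀ w' ε t,
      (∑ l, Real.exp (δ l * t) • Function.update S 0 (S 0 + ε • Mw w') l).det = P w' ε t := by
    intro w' ε t
    rw [expPencil_update_zero]
  have hP0 : ∀ w' t, P w' 0 t = G t := fun w' t => by simp [hP, hG]
  have hPcont : ∀ w' t, Continuous fun ε => P w' ε t := by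
    intro w' t
    simp only [hP]
    exact (continuous_const.add ((continuous_id.mul continuous_const).smul continuous_const)).matrix_det
  -- the kernel blocks of the conjugated letters
  set c : ℝ → Bool → ℝ := fun z b =>
    ((star (U z) * V b * U z).submatrix (fun i : {i // eig z i = 0} => (i : Fin m))
      (fun i : {i // eig z i = 0} => (i : Fin m))).det with hc
  have hc_true : ∀ z, c z true = 1 := by
    intro z
    simp only [hc, hV, if_true, hUz]
    rw [star_mul_one_mul_eigenvectorUnitary, submatrix_one_val, Matrix.det_one]
  have hc_false : ∀ z, c z false = 1 - κ * q z := by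
    intro z
    simp only [hc, hV, Bool.false_eq_true, if_false, hW, hq, hw, hUz]
    rw [star_mul_one_sub_smul_vecMulVec_mul_eigenvectorUnitary, submatrix_one_sub_smul_vecMulVec_val,
      det_one_sub_smul_vecMulVec']
  have hc_ne : ∀ z, G z = 0 → ∀ b, c z b ≠ 0 := by
    intro z hz b
    cases b
    · rw [hc_false]; have := hκq z hz; linarith
    · rw [hc_true]; exact one_ne_zero
  -- product of the non-zero eigenvalues
  set π : ℝ → ℝ := fun z => ∏ i : {i // ¬ eig z i = 0}, eig z i with hπ
  have hπ_ne : ∀ z, π z ≠ 0 := fun z => Finset.prod_ne_zero_iff.mpr fun i _ => i.2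
  -- eventual sign of every member at every zero
  have hsign : ∀ z, G z = 0 → ∀ b s, ∀ᶠ ε in 𝓝[>] (0 : ℝ),
      0 < ((sg s) ^ Fintype.card {i // eig z i = 0} * c z b * π z) * P (b, s) ε z := by
    intro z hz b s
    set E := Real.exp (δ 0 * z) with hE
    have hEpos : 0 < E := Real.exp_pos _
    have hkey := eventually_pos_det_diagonal_add_smul (eig z) (star (U z) * V b * U z) (hc_ne z hz b)
    -- transport along `x = ε E σ`
    have htend : Tendsto (fun ε : ℝ => ε * E * sg s) (𝓝[>] (0 : ℝ)) (𝓝 0) := by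
      have h1 : Tendsto (fun ε : ℝ => ε * E * sg s) (𝓝 (0 : ℝ)) (𝓝 (0 * E * sg s)) :=
        ((continuous_id.mul continuous_const).mul continuous_const).tendsto 0
      rw [zero_mul, zero_mul] at h1
      exact h1.mono_left nhdsWithin_le_nhds
    have h2 : ∀ᶠ ε in 𝓝[>] (0 : ℝ), 0 < ε := eventually_mem_nhdsWithin
    filter_upwards [htend.eventually hkey, h2] with ε hε hεpos
    have hx0 : ε * E * sg s ≠ 0 := mul_ne_zero (mul_pos hεpos hEpos).ne' (hsg_ne s)
    have h3 := hε hx0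
    have hdiag : (Matrix.diagonal (eig z) + (ε * E * sg s) • (star (U z) * V b * U z)).det =
        (F z + (ε * E * sg s) • V b).det := by
      rw [hUz, ← heig]; exact (det_add_smul_eq_det_diagonal (hH z) (V b) _).symm
    rw [hdiag] at h3
    have hmat : F z + (ε * E * sg s) • V b = F z + (ε * E) • Mw (b, s) := by
      simp only [hMw, smul_smul]
    rw [hmat] at h3
    have hpow : (ε * E * sg s) ^ Fintype.card {i // eig z i = 0} =
        (ε * E) ^ Fintype.card {i // eig z i = 0} * (sg s) ^ Fintype.card {i // eig z i = 0} := by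
      rw [mul_pow]
    rw [hpow] at h3
    have hEpow : 0 < (ε * E) ^ Fintype.card {i // eig z i = 0} := pow_pos (mul_pos hεpos hEpos) _
    have hre : (ε * E) ^ Fintype.card {i // eig z i = 0} * sg s ^ Fintype.card {i // eig z i = 0} *
        c z b * π z * P (b, s) ε z =
        (ε * E) ^ Fintype.card {i // eig z i = 0} *
          ((sg s ^ Fintype.card {i // eig z i = 0} * c z b * π z) * P (b, s) ε z) := by
      simp only [hP, hc, hπ]; ring
    rw [hre] at h3
    exact pos_of_mul_pos_right h3 hEpow.le
  -- (a) non-vanishing and (b) balance at every zero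
  have hPne : ∀ w' z, G z = 0 → ∀ᶠ ε in 𝓝[>] (0 : ℝ), P w' ε z ≠ 0 := by
    intro w' z hz
    obtain ⟨b, s⟩ := w'
    exact (hsign z hz b s).mono fun ε h h0 => by rw [h0, mul_zero] at h; exact lt_irrefl _ h
  have hbal : ∀ z, G z = 0 →
      Fintype.card (Bool × Bool) ≤
          2 * (univ.filter (fun w' => ∀ᶠ ε in 𝓝[>] (0 : ℝ), P w' ε z < 0)).card ∧
        Fintype.card (Bool × Bool) ≤
          2 * (univ.filter (fun w' => ∀ᶠ ε in 𝓝[>] (0 : ℝ), 0 < P w' ε z)).card := by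
    intro z hz
    refine balance_of_opposite_pairs (fun w' ε => P w' ε z)
      (fun s => (sg s) ^ Fintype.card {i // eig z i = 0} * c z true * π z) (fun _ => c z false)
      (fun _ => by rw [hc_false]; have := hκq z hz; linarith)
      (fun s => mul_ne_zero (mul_ne_zero (pow_ne_zero _ (hsg_ne s)) (hc_ne z hz true)) (hπ_ne z))
      (fun s => hsign z hz true s) (fun s => ?_)
    have h := hsign z hz false s
    refine h.mono fun ε hε => ?_
    have : c z false * (sg s ^ Fintype.card {i // eig z i = 0} * c z true * π z) * P (false, s) ε z =
        (sg s ^ Fintype.card {i // eig z i = 0} * c z false * π z) * P (false, s) ε z := by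
      rw [hc_true]; ring
    rw [this]; exact hε
  -- STEP 4: the family lemma
  obtain ⟨w', ε, Mn, p, hpmono, hcount⟩ := exists_signVar_of_zeros_family (ι := Bool × Bool) G hfin
    hN0 hN P hP0 hPcont (fun w' z hz => hPne w' z hz) hbal
  refine ⟨Mw w', ε, hMsymm w', Mn, p, hpmono, ?_⟩
  simp only [hP_det]
  exact hcount

/-- **The real-exponent transfer for EVERY size and EVERY bound.**  For all `m`, `K`, `B`:
`PosRootLawAt m K B` (every real symmetric `m × m` pencil with `K` lacunary terms on an INTEGER
support has `≤ B` distinct positive det-roots) iff the same holds for every REAL exponent vector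
`δ : Fin K → ℝ` (zeros of `x ↦ det ∑_l x^{δ_l} S_l` on `(0,∞)`, `Set.ncard`).  No sharpness hypothesis
(module docstring). [folklore] -/
theorem posRootLawAt_iff_rpow_all (m K B : ℕ) :
    PosRootLawAt m K B ↔
      ∀ (δ : Fin K → ℝ) (S : Fin K → Matrix (Fin m) (Fin m) ℝ), (∀ l, (S l).IsSymm) →
        {x : ℝ | 0 < x ∧ (∑ l, (x ^ (δ l)) • S l).det = 0}.ncard ≤ B := by
  classical
  refine ⟨fun hlaw δ S hS => ?_, posRootLawAt_of_rpow⟩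
  rcases K.eq_zero_or_pos with hK | hK
  · subst hK
    rcases isEmpty_or_nonempty (Fin m) with hm | hm
    · -- `m = 0`: the determinant is `1`, there are no zeros
      have : {x : ℝ | 0 < x ∧ (∑ l : Fin 0, (x ^ (δ l)) • S l).det = 0} = ∅ := by
        ext x
        simp [Matrix.det_isEmpty]
      rw [this, Set.ncard_empty]
      exact Nat.zero_le B
    · have : {x : ℝ | 0 < x ∧ (∑ l : Fin 0, (x ^ (δ l)) • S l).det = 0} = Set.Ioi 0 := by
        ext x
        simp
      rw [this, (Set.Ioi_infinite 0).ncard]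
      exact Nat.zero_le B
  obtain ⟨k, rfl⟩ : ∃ k, K = k + 1 := ⟨K - 1, by omega⟩
  by_contra hcon
  push Not at hcon
  rw [ncard_rpow_eq_ncard_exp δ S] at hcon
  obtain ⟨W, ε, hW, M, p, hp, hvar⟩ := exists_signVar_of_zeros_symm δ S hS (Nat.succ_pos B) hcon
  have hbound := card_signVar_le hlaw δ _ (isSymm_update_zero S hS W hW ε) p hp
  omega

/-- **The negation currency over real exponents (every size, every bound).**  `¬ PosRootLawAt m K B`
iff some REAL exponent vector carries a real symmetric `m × m` pencil with `≥ B + 1` zeros on `(0,∞)`.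
[folklore] -/
theorem not_posRootLawAt_iff_all (m K B : ℕ) :
    ¬ PosRootLawAt m K B ↔ ∃ (δ : Fin K → ℝ) (S : Fin K → Matrix (Fin m) (Fin m) ℝ),
      (∀ l, (S l).IsSymm) ∧ B + 1 ≤ {x : ℝ | 0 < x ∧ (∑ l, (x ^ (δ l)) • S l).det = 0}.ncard := by
  rw [posRootLawAt_iff_rpow_all]
  push Not
  constructor
  · rintro ⟨δ, S, hS, h⟩; exact ⟨δ, S, hS, by omega⟩
  · rintro ⟨δ, S, hS, h⟩; exact ⟨δ, S, hS, by omega⟩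

end AllSizes

end Summit.ValiantsHypothesis.ValiantsHypothesis.Theorems.LacunarySymmetroidMatrixDescartes.Census.RealExp
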